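import Summits.BirchSwinnertonDyer.BirchSwinnertonDyer.Theorems.SignedLowerHalvesSmallImageLowerHalfBothSignsRttCharRoadE1QuadraticDescent
import HarnessLib

/-!
# Route `SignedLowerHalves`, crux L `SmallImageLowerHalfBothSigns` (stmt-BirchSwinnertonDyer-23599), line `rtt_w3` v10 — brick D3-a of COUNT_π
# (memo `Lines/rtt_w3-BRIEF-E1b-g6.md` §9.3, route D, the local conditions AWAY FROM `p`): a condition «restriction to `I` vanishes»
# (`I → G` any compatible continuous homomorphism — an inertia group) ASCENDS along the quadratic step: for `M` killed by an odd prime,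
# `res_I η = 0` as soon as `res_{I ∩ N} η = 0`, where `I ∩ N = φ⁻¹(N)` has index `≤ 2` in `I` — so «unramified outside `S₀K` over `K_n`»
# implies «unramified outside `S₀` over `ℚ_n`» for the descended class of brick D1.

Width seat `bsd-line-slh-p3-w3` g16 under LEAD `cruxlead-stmt-BirchSwinnertonDyer-23599` g6 (cell `bsd-ssimc`; `--supports stmt-BirchSwinnertonDyer-23599 --as helper`).
THEOREMS ONLY (no definition, no named fact, no instance, no `sorry`); generic continuous group cohomology in the currency of brick D1
(`…RttCharRoadE1QuadraticDescent`, p763571: `resSubgroupH1_injective_of_prime_ne_two`). BSD / crux L / COUNT are NOT proved here.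

SETTING. `N ≤ G` open normal with `G = N ⊔ Nc` (as `Xor`), `M` a discrete `G`-module with continuous orbit maps, `I` a topological group
acting on `M` THROUGH a continuous homomorphism `φ : I → G` (`φ x • m = x • m`; in COUNT: `I = I_v ∩ Γ_{ℚ_n}` an inertia group at `v ∤ p`,
`φ` its inclusion, `N ∩ Γ_{ℚ_n} = Γ_{K_n}`, `φ⁻¹(N) = I_v ∩ Γ_{K_n}` the inertia group of `K_n` at a place above `v`).

WHAT:
* `xor_comap_of_not_mem` — `φ⁻¹(N)` inherits the index-`2` presentation `I = φ⁻¹(N) ⊔ φ⁻¹(N)c'` from any `c' ∈ I` with `φ c' ∉ N`;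
  `continuous_smul_of_compatible` — orbit maps of `I` are continuous.
* `resSubgroupH1_top_injective` — restriction to the improper subgroup `⊤ ≤ I` is injective (cocycle level).
* ★ `resH1Hom_eq_zero_of_comp_subgroupIncl_comap_eq_zero` — **`res_{φ⁻¹(N)} η = 0 ⇒ res_I η = 0`** for every `η ∈ H¹(G, M)`, `M` killed by an odd
  prime: if `φ(I) ⊆ N` the two restrictions agree (`⊤`-injectivity); otherwise brick D1 on `(I, φ⁻¹(N), c')`. ★ `resH1Hom_eq_zero_iff_comp`: `↔`.

References: [SerreGaloisCohomology1997] I §2.4 Prop. 9, I §2.6 (b); [NeukirchSchmidtWingberg2008] (1.6.7); [Rubin1991] §4 (motivation).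
-/

set_option autoImplicit false
set_option linter.dupNamespace false -- D-0017: single-problem summit, the namespace repeats the problem name by design
noncomputable section

open scoped Classical

universe u

namespace Summit.BirchSwinnertonDyer.BirchSwinnertonDyer.Theorems.SmallImageCharSignedSelmer

open Literature.NumberTheory.EllipticCurves Literature.NumberTheory.GaloisRepresentations

section Descent

variable {G : Type u} [Group G] [TopologicalSpace G] [IsTopologicalGroup G] {N : Subgroup G} {c : G}
  {M : Type u} [AddCommGroup M] [DistribMulAction G M] [TopologicalSpace M] [DiscreteTopology M]
  {I : Type u} [Group I] [TopologicalSpace I] [IsTopologicalGroup I] [DistribMulAction I M]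
  (φ : I →ₜ* G) (hφ : ∀ (x : I) (m : M), φ x • m = x • m)

omit [TopologicalSpace G] [IsTopologicalGroup G] [TopologicalSpace I] [IsTopologicalGroup I] in
/-- The index-`2` presentation descends to `φ⁻¹(N) ≤ I` through any `c' ∈ I` with `φ c' ∉ N`. [folklore] -/
theorem xor_comap_of_not_mem (hc : ∀ b : G, Xor (b * c⁻¹ ∈ N) (b ∈ N)) (φ' : I →* G) {c' : I} (hc' : φ' c' ∉ N) (b : I) :
    Xor (b * c'⁻¹ ∈ N.comap φ') (b ∈ N.comap φ') := by
  rw [Subgroup.mem_comap, Subgroup.mem_comap, map_mul, map_inv]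
  by_cases hb : φ' b ∈ N
  · refine Or.inr ⟨hb, fun h ↦ hc' ?_⟩
    have h1 : (φ' c')⁻¹ ∈ N := (Subgroup.mul_mem_cancel_left N hb).1 h
    exact (Subgroup.inv_mem_iff N).1 h1
  · refine Or.inl ⟨?_, hb⟩
    have h1 := mul_inv_mem_of_not_mem hc hb
    have h2 := mul_inv_mem_of_not_mem hc hc'
    have h3 : φ' b * (φ' c')⁻¹ = φ' b * c⁻¹ * (φ' c' * c⁻¹)⁻¹ := by group
    rw [h3]
    exact N.mul_mem h1 (N.inv_mem h2)

omit [IsTopologicalGroup G] [IsTopologicalGroup I] [DiscreteTopology M] in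
include hφ in
/-- Orbit maps of `I` are continuous when `I` acts through `φ` and the orbit maps of `G` are. [folklore] -/
theorem continuous_smul_of_compatible (hM : ∀ m : M, Continuous fun g : G ↦ g • m) (m : M) :
    Continuous fun x : I ↦ x • m := by
  have h : (fun x : I ↦ x • m) = (fun g : G ↦ g • m) ∘ φ := by
    funext x; exact (hφ x m).symm
  rw [h]
  exact (hM m).comp φ.continuous_toFun

/-- Restriction to the improper subgroup `⊤ ≤ I` is injective on `H¹(I, M)` (a cocycle which is a coboundary on `⊤` is a coboundary).
[folklore] -/
theorem resSubgroupH1_top_injective : Function.Injective (resSubgroupH1 (⊤ : Subgroup I) M) := by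
  rw [injective_iff_map_eq_zero]
  intro η hη
  obtain ⟨f, rfl⟩ := oneCocycleClass_surjective _ η
  rw [resSubgroupH1_oneCocycleClass, oneCocycleClass_eq_zero_iff] at hη
  obtain ⟨m, hm⟩ := hη
  rw [oneCocycleClass_eq_zero_iff]
  refine ⟨m, fun x ↦ ?_⟩
  have h := hm ⟨x, Subgroup.mem_top x⟩
  rw [resCocycle_apply] at h
  exact h

include hφ in
/-- ★ **`res_{φ⁻¹(N)} η = 0 ⇒ res_I η = 0` for `M` killed by an odd prime** (`η ∈ H¹(G, M)`; restriction along `φ : I → G` and along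
`φ ∘ (φ⁻¹(N) ↪ I)`). If `φ(I) ⊆ N` then `φ⁻¹(N) = ⊤` and the two restrictions differ by the injective `res_⊤`; otherwise `φ⁻¹(N)` is open
normal of index `2` in `I` (`xor_comap_of_not_mem`) and brick D1 (`resSubgroupH1_injective_of_prime_ne_two`) applies to
`res_I η ∈ H¹(I, M)`. In COUNT: unramified at the places of `K_n` above `v ∤ p` ⇒ unramified at `v` over `ℚ_n`.
[cite: SerreGaloisCohomology1997, I §2.4 Prop. 9] [cite: NeukirchSchmidtWingberg2008, (1.6.7)] -/
theorem resH1Hom_eq_zero_of_comp_subgroupIncl_comap_eq_zero (hN : IsOpen (N : Set G)) (hM : ∀ m : M, Continuous fun g : G ↦ g • m)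
    (hc : ∀ b : G, Xor (b * c⁻¹ ∈ N) (b ∈ N)) {p : ℕ} (hp : p.Prime) (hp2 : p ≠ 2) (hpM : ∀ a : M, p • a = 0)
    (η : discreteH1 G M)
    (h : resH1Hom (φ.comp (subgroupIncl (N.comap (φ : I →* G)))) (AddMonoidHom.id M)
      (fun x m ↦ hφ (x : I) m) η = 0) :
    resH1Hom φ (AddMonoidHom.id M) (fun x m ↦ hφ x m) η = 0 := by
  set J : Subgroup I := N.comap (φ : I →* G) with hJ
  have hMI : ∀ m : M, Continuous fun x : I ↦ x • m := continuous_smul_of_compatible φ hφ hM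
  -- `res_J ∘ res_φ = res_{φ ∘ incl_J}`
  have hcomp : resSubgroupH1 J M (resH1Hom φ (AddMonoidHom.id M) (fun x m ↦ hφ x m) η) = 0 := by
    rw [resSubgroupH1, ← AddMonoidHom.comp_apply, resH1Hom_comp]
    exact h
  by_cases hI : ∀ x : I, φ x ∈ N
  · -- `J = ⊤`
    have hJtop : J = ⊤ := by
      ext x; exact ⟨fun _ ↦ trivial, fun _ ↦ hI x⟩
    clear_value J
    subst hJtop
    exact resSubgroupH1_top_injective (by rw [hcomp, map_zero])
  · push Not at hI
    obtain ⟨c', hc'⟩ := hI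
    have hJopen : IsOpen (J : Set I) := hN.preimage φ.continuous_toFun
    haveI : N.Normal := by
      refine ⟨fun n hn g ↦ ?_⟩
      rcases exists_eq_or_eq_mul hc g with ⟨m, rfl⟩ | ⟨m, rfl⟩
      · exact N.mul_mem (N.mul_mem m.2 hn) (N.inv_mem m.2)
      · have h1 : (m : G) * c * n * ((m : G) * c)⁻¹ = m * (c * n * c⁻¹) * (m : G)⁻¹ := by group
        rw [h1]
        refine N.mul_mem (N.mul_mem m.2 ?_) (N.inv_mem m.2)
        -- `c n c⁻¹ ∈ N`: `(c n) c⁻¹ ∈ N` since `c n ∉ N`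
        refine mul_inv_mem_of_not_mem hc fun hcn ↦ not_mem_of_xor hc ?_
        exact (Subgroup.mul_mem_cancel_right N hn).1 hcn
    haveI : J.Normal := Subgroup.normal_comap _
    have hcJ : ∀ b : I, Xor (b * c'⁻¹ ∈ J) (b ∈ J) := xor_comap_of_not_mem hc (φ : I →* G) hc'
    exact resSubgroupH1_injective_of_prime_ne_two hJopen hMI hcJ hp hp2 hpM (by rw [hcomp, map_zero])

include hφ in
/-- ★ **`res_I η = 0 ↔ res_{φ⁻¹(N)} η = 0`** (`M` killed by an odd prime; `⇒` is functoriality). In COUNT, for the descended class `η` of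
brick D1 (`res_N η = ξ`): `η` is unramified at `v ∤ p` over `ℚ_n` iff `ξ` is unramified at the places above `v` over `K_n`.
[cite: SerreGaloisCohomology1997, I §2.4 Prop. 9] -/
theorem resH1Hom_eq_zero_iff_comp (hN : IsOpen (N : Set G)) (hM : ∀ m : M, Continuous fun g : G ↦ g • m)
    (hc : ∀ b : G, Xor (b * c⁻¹ ∈ N) (b ∈ N)) {p : ℕ} (hp : p.Prime) (hp2 : p ≠ 2) (hpM : ∀ a : M, p • a = 0)
    (η : discreteH1 G M) :
    resH1Hom φ (AddMonoidHom.id M) (fun x m ↦ hφ x m) η = 0 ↔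
      resH1Hom (φ.comp (subgroupIncl (N.comap (φ : I →* G)))) (AddMonoidHom.id M) (fun x m ↦ hφ (x : I) m) η = 0 := by
  refine ⟨fun h ↦ ?_, resH1Hom_eq_zero_of_comp_subgroupIncl_comap_eq_zero φ hφ hN hM hc hp hp2 hpM η⟩
  have hcomp : resH1Hom (φ.comp (subgroupIncl (N.comap (φ : I →* G)))) (AddMonoidHom.id M) (fun x m ↦ hφ (x : I) m) η =
      resSubgroupH1 (N.comap (φ : I →* G)) M (resH1Hom φ (AddMonoidHom.id M) (fun x m ↦ hφ x m) η) := by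
    rw [resSubgroupH1, ← AddMonoidHom.comp_apply, resH1Hom_comp]
    rfl
  rw [hcomp, h, map_zero]

end Descent

end Summit.BirchSwinnertonDyer.BirchSwinnertonDyer.Theorems.SmallImageCharSignedSelmer

end
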